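import Literature.NumberTheory.EllipticCurves.Disegni2017.ChiLineGrossZagier
import Literature.NumberTheory.EllipticCurves.HeightsBaseChangeProofs
import Literature.NumberTheory.EllipticCurves.RegulatorProofs
import Literature.NumberTheory.EllipticCurves.RegulatorBasisProofs
import HarnessLib

/-!
# Disegni 2017 at a SIGN character: the `χ`-isotypic pairings evaluate on ONE line (proved)

Topic `Literature/NumberTheory/EllipticCurves`, cluster `Disegni2017`. THEOREMS ONLY (no definition, no
named fact, no `sorry`); companion of `ChiLineGrossZagier.lean` (`chiHeightPairing`, `chiPAdicPairing`,
`ChiLineGrossZagierClauses`). Written by the width seat `bsd-line-cf2-p1-w8` (g22) of cell `bsd-print-cf2`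
for road (C) `disegni-pair-two` of the crux `PrintCf2.SplitBadTwoRankOneOfFacts` — the seam «Disegni's
datum pinned on the image of the member» (typer residue (R2), planner PREGRADE §3 seam S1). BSD is not
proved by any of this.

## What is proved, and why the consumer needs it

In `ChiLineGrossZagierClauses ι K W H f a χ_H 𝔭 𝔭′ G χ DH` the two `H`-points `y₁, y₂` and the complex
number `q ≠ 0` are EXISTENTIALLY bound; the only handle on them is that the SAME `(y₁, y₂, q)` occur in
the archimedean clause (`[H:ℚ]⁻¹·chiHeightPairing … y₁ y₂ = (q/2)·Car·Λ′(1)`) and in the `p`-adic clause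
(`chiPAdicPairing … DH … y₁ y₂ = σ₀·ι⁻¹(q·Z°⁻¹)·½log_p γ·[T¹]G_χ`). To extract a statement about the
member's generator one must evaluate BOTH pairings at an ARBITRARY pair `(y₁, y₂)` in terms of one point.
For a SIGN character — `χ(σ) = s(σ) ∈ {±1}` (the road-(C) character `ε_{d*}∘N` read on
`G = Gal(H/E′)`, `H = E′(√d*)`) — this file proves, for `Y_χ(y) := Σ_{σ ∈ G} s(σ)·σy`:

* §1 (any biadditive pairing `B` on an additive group with a `G`-action): `Σ_σ s(σ)·B(σy₁, y₂) =
  B(Y_χ y₁, y₂)`; `τ(Y_χ y) = s(τ)·Y_χ y`; if `B` is `G`-INVARIANT, `|G|·B(Y_χ y₁, y₂) = B(Y_χ y₁, Y_χ y₂)`;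
  and the RANK-ONE EVALUATION: `mᵢ·Y_χ yᵢ = kᵢ·R + Tᵢ` (`Tᵢ` torsion, `B` killing torsion) gives
  `m₁m₂·B(Y_χ y₁, Y_χ y₂) = k₁k₂·B(R, R)`.
* §2 the Néron–Tate case (`chiHeightPairing`; invariance is the THEOREM `heightPairing_map_self`):
  `chiHeightPairing W H G χ y₁ y₂ = ⟨Y_χ y₁, y₂⟩_{NT,H}`, `|G|·⟨Y_χ y₁, y₂⟩ = ⟨Y_χ y₁, Y_χ y₂⟩`, and
  `|G|·m₁m₂·chiHeightPairing … y₁ y₂ = k₁k₂·ĥ_H(R)`.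
* §3 the `p`-adic case (`chiPAdicPairing` over an ABSTRACT `DH : PAdicHeightDataK W p H`): the same, with
  the `G`-INVARIANCE OF `DH` AS A DISPLAYED HYPOTHESIS — the structure `PAdicHeightDataK` (a symmetric
  bilinear pairing vanishing on torsion) does not carry it; Disegni's pairing (1.3.2) has it by
  construction ([p7 L40–44]: «its equivariance properties under the action of `𝒢_F`»).

So on a `χ`-line of rank one both clauses read the SAME rational multiple `k₁k₂/(|G|m₁m₂)` of `ĥ_H(R)`,
resp. `⟨R, R⟩_{DH}` — which is what lets the consumer divide the clauses and cancel `q`.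

References: [Disegni2017] D. Disegni, Compos. Math. 153 (2017) = arXiv:1510.02114v3, §1.1.1 (the
projector `P(f,χ)`), (1.1.3), (1.3.1)–(1.3.2), Theorem B (PDF p. 8); [SilvermanAEC2009] J. H. Silverman,
AEC, Thm. VIII.9.3; [BombieriGubler2001] Prop. 1.5.17 (Galois invariance of heights).
-/

noncomputable section

open scoped Classical

namespace Literature.NumberTheory.EllipticCurves.Disegni2017

/-! ### §1 Sign-character algebra for a biadditive pairing with a group action -/

section Algebra

variable {A : Type*} [AddCommGroup A] {R : Type*} [CommRing R]
  {G : Type*} [Group G] [Fintype G]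
  (ρ : G →* AddMonoid.End A) (s : G → ℤ) (B : A → A → R)

omit [Fintype G] in
/-- For a sign function (`s(σ)² = 1`, `s(στ) = s(σ)s(τ)`): `s(1) = 1`.
[cite: Disegni2017, §1.1.1 (arXiv v3 PDF p. 3 L32–40)] -/
theorem sign_one (hmul : ∀ σ τ, s (σ * τ) = s σ * s τ) (hsq : ∀ σ, s σ * s σ = 1) : s 1 = 1 := by
  have h1 : s 1 * s 1 = s 1 := by rw [← hmul, one_mul]
  have h2 : s 1 * s 1 = 1 := hsq 1
  rw [h1] at h2
  exact h2

omit [Fintype G] in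
/-- For a sign function (`s(σ)² = 1`, `s(στ) = s(σ)s(τ)`): `s(σ⁻¹) = s(σ)`.
[cite: Disegni2017, §1.1.1 (arXiv v3 PDF p. 3 L32–40)] -/
theorem sign_inv (hmul : ∀ σ τ, s (σ * τ) = s σ * s τ) (hsq : ∀ σ, s σ * s σ = 1) (σ : G) :
    s σ⁻¹ = s σ := by
  have h : s σ * s σ⁻¹ = 1 := by rw [← hmul, mul_inv_cancel, sign_one s hmul hsq]
  calc s σ⁻¹ = s σ * s σ * s σ⁻¹ := by rw [hsq, one_mul]
    _ = s σ := by rw [mul_assoc, h, mul_one]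

omit [Fintype G] in
/-- `ℤ`-linearity of a first-variable-additive pairing: `B(n·a, c) = n·B(a, c)`.
[cite: SilvermanAEC2009, Thm. VIII.9.3(c)] -/
theorem pairing_zsmul_left (hadd : ∀ a b c, B (a + b) c = B a c + B b c) (n : ℤ) (a c : A) :
    B (n • a) c = (n : R) * B a c := by
  let φ : A →+ R := AddMonoidHom.mk' (fun a => B a c) (fun a b => hadd a b c)
  have hφ : ∀ a, φ a = B a c := fun _ => rfl
  rw [← hφ, map_zsmul, hφ, zsmul_eq_mul]

omit [Fintype G] in
/-- `ℤ`-linearity of a second-variable-additive pairing: `B(a, n·c) = n·B(a, c)`.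
[cite: SilvermanAEC2009, Thm. VIII.9.3(c)] -/
theorem pairing_zsmul_right (hadd' : ∀ a b c, B a (b + c) = B a b + B a c) (n : ℤ) (a c : A) :
    B a (n • c) = (n : R) * B a c := by
  let φ : A →+ R := AddMonoidHom.mk' (fun c => B a c) (fun b c => hadd' a b c)
  have hφ : ∀ c, φ c = B a c := fun _ => rfl
  rw [← hφ, map_zsmul, hφ, zsmul_eq_mul]

/-- **Linearity in the first variable**: `Σ_σ s(σ)·B(σy₁, y₂) = B(Y_χ y₁, y₂)` with
`Y_χ y := Σ_σ s(σ)·σy`, for `B` additive in the first variable.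
[cite: Disegni2017, §1.1.1 P(f,χ) (arXiv v3 PDF p. 3 L32–40)] -/
theorem sum_sign_mul_pairing_eq (hadd : ∀ a b c, B (a + b) c = B a c + B b c) (y₁ y₂ : A) :
    ∑ σ, (s σ : R) * B (ρ σ y₁) y₂ = B (∑ σ, s σ • ρ σ y₁) y₂ := by
  let φ : A →+ R := AddMonoidHom.mk' (fun a => B a y₂) (fun a b => hadd a b y₂)
  have hφ : ∀ a, φ a = B a y₂ := fun _ => rfl
  rw [← hφ, map_sum]
  refine Finset.sum_congr rfl fun σ _ => ?_
  rw [map_zsmul, hφ, zsmul_eq_mul]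

omit [Fintype G] in
/-- Composition of the action: `τ(σ y) = (τσ) y`. [cite: Disegni2017, §1.1.1 (arXiv v3 PDF p. 3 L32–40)] -/
theorem act_act (τ σ : G) (y : A) : ρ τ (ρ σ y) = ρ (τ * σ) y := by
  rw [map_mul, AddMonoid.End.coe_mul, Function.comp_apply]

omit [Fintype G] in
/-- `τ (τ⁻¹ a) = a` for the action. [cite: Disegni2017, §1.1.1 (arXiv v3 PDF p. 3 L32–40)] -/
theorem act_act_inv (τ : G) (a : A) : ρ τ (ρ τ⁻¹ a) = a := by
  rw [act_act, mul_inv_cancel, map_one, AddMonoid.End.coe_one, id]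

/-- **The action on the projector**: `τ(Y_χ y) = s(τ)·Y_χ y` (reindex the sum by `σ ↦ τσ`;
`s(τσ)·s(τ) = s(σ)`). [cite: Disegni2017, §1.1.1 A(χ) (arXiv v3 PDF p. 3 L40)] -/
theorem act_sum_sign_smul (hmul : ∀ σ τ, s (σ * τ) = s σ * s τ) (hsq : ∀ σ, s σ * s σ = 1)
    (τ : G) (y : A) :
    ρ τ (∑ σ, s σ • ρ σ y) = s τ • ∑ σ, s σ • ρ σ y := by
  rw [map_sum, Finset.smul_sum]
  simp_rw [map_zsmul, act_act ρ, smul_smul]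
  refine Fintype.sum_equiv (Equiv.mulLeft τ) _ _ fun σ => ?_
  simp only [Equiv.coe_mulLeft]
  congr 1
  rw [hmul, ← mul_assoc, hsq, one_mul]

/-- **Doubling by invariance**: for a `G`-INVARIANT biadditive pairing,
`|G|·B(Y_χ y₁, y₂) = B(Y_χ y₁, Y_χ y₂)`. [cite: Disegni2017, (1.3.2) (arXiv v3 PDF p. 7 L40–44)] -/
theorem card_mul_pairing_sum_eq (hmul : ∀ σ τ, s (σ * τ) = s σ * s τ) (hsq : ∀ σ, s σ * s σ = 1)
    (hadd : ∀ a b c, B (a + b) c = B a c + B b c) (hadd' : ∀ a b c, B a (b + c) = B a b + B a c)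
    (hinv : ∀ (τ : G) (a b : A), B (ρ τ a) (ρ τ b) = B a b) (y₁ y₂ : A) :
    (Fintype.card G : R) * B (∑ σ, s σ • ρ σ y₁) y₂ =
      B (∑ σ, s σ • ρ σ y₁) (∑ σ, s σ • ρ σ y₂) := by
  set Y₁ := ∑ σ, s σ • ρ σ y₁ with hY₁
  let ψ : A →+ R := AddMonoidHom.mk' (fun b => B Y₁ b) (fun b c => hadd' Y₁ b c)
  have hψ : ∀ b, ψ b = B Y₁ b := fun _ => rfl
  rw [← hψ (∑ σ, s σ • ρ σ y₂), map_sum]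
  simp_rw [map_zsmul, hψ, zsmul_eq_mul]
  have hterm : ∀ τ : G, (s τ : R) * B Y₁ (ρ τ y₂) = B Y₁ y₂ := fun τ => by
    have h1 : B Y₁ (ρ τ y₂) = B (ρ τ⁻¹ Y₁) y₂ := by
      conv_lhs => rw [← act_act_inv ρ τ Y₁]
      exact hinv τ _ _
    rw [h1, hY₁, act_sum_sign_smul ρ s hmul hsq, ← hY₁, sign_inv s hmul hsq,
      pairing_zsmul_left B hadd, ← mul_assoc, ← Int.cast_mul, hsq, Int.cast_one, one_mul]
  simp_rw [hterm]
  rw [Finset.sum_const, Finset.card_univ, nsmul_eq_mul]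

omit [Fintype G] in
/-- **Rank-one evaluation**: if `m₁·Y₁ = k₁·R + T₁`, `m₂·Y₂ = k₂·R + T₂` with `T₁, T₂` torsion and `B`
biadditive, killing torsion in each variable, then `m₁m₂·B(Y₁, Y₂) = k₁k₂·B(R, R)`.
[cite: SilvermanAEC2009, Thm. VIII.9.3(c)-(d)] -/
theorem mul_mul_pairing_eq_of_zsmul_eq (hadd : ∀ a b c, B (a + b) c = B a c + B b c)
    (hadd' : ∀ a b c, B a (b + c) = B a b + B a c)
    (htors : ∀ a b, IsOfFinAddOrder a → B a b = 0) (htors' : ∀ a b, IsOfFinAddOrder b → B a b = 0)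
    {Y₁ Y₂ P T₁ T₂ : A} {m₁ m₂ k₁ k₂ : ℤ}
    (h₁ : m₁ • Y₁ = k₁ • P + T₁) (h₂ : m₂ • Y₂ = k₂ • P + T₂)
    (hT₁ : IsOfFinAddOrder T₁) (hT₂ : IsOfFinAddOrder T₂) :
    (m₁ : R) * (m₂ : R) * B Y₁ Y₂ = (k₁ : R) * (k₂ : R) * B P P := by
  have h : B (m₁ • Y₁) (m₂ • Y₂) = (m₁ : R) * (m₂ : R) * B Y₁ Y₂ := by
    rw [pairing_zsmul_left B hadd, pairing_zsmul_right B hadd']; ring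
  rw [← h, h₁, h₂, hadd, hadd', hadd', htors T₁ _ hT₁, htors T₁ _ hT₁, htors' _ T₂ hT₂,
    pairing_zsmul_left B hadd, pairing_zsmul_right B hadd']
  ring

end Algebra

/-! ### §2 The Néron–Tate `χ`-pairing `chiHeightPairing` at a sign character -/

section NeronTate

open WeierstrassCurve WeierstrassCurve.Affine.Point

variable {W : WeierstrassCurve ℚ} [W.IsElliptic] {H : Type} [Field H] [NumberField H]
  (G : Subgroup (H ≃ₐ[ℚ] H)) (χ : G →* ℂˣ) (s : G → ℤ)

/-- A `ℂˣ`-valued character of a finite group with INTEGER values is a sign character: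
`s(στ) = s(σ)s(τ)` and `s(σ)² = 1`. [cite: Disegni2017, §1.1.1 (arXiv v3 PDF p. 3 L32–40)] -/
theorem sign_mul_and_sq_of_eq (hs : ∀ σ, ((χ σ : ℂˣ) : ℂ) = (s σ : ℂ)) :
    (∀ σ τ, s (σ * τ) = s σ * s τ) ∧ (∀ σ, s σ * s σ = 1) := by
  have hmul : ∀ σ τ, s (σ * τ) = s σ * s τ := fun σ τ => by
    have h := hs (σ * τ)
    rw [map_mul, Units.val_mul, hs, hs] at h
    exact_mod_cast h.symm
  refine ⟨hmul, fun σ => ?_⟩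
  -- `χ σ` has finite order, so `(s σ)^n = 1` for some `n ≥ 1`, whence `|s σ| = 1`
  have hfin : IsOfFinOrder (χ σ) := χ.isOfFinOrder (isOfFinOrder_of_finite σ)
  obtain ⟨n, hn, hpow⟩ := hfin.exists_pow_eq_one
  have hZ : (s σ) ^ n = 1 := by
    have h : ((χ σ : ℂˣ) : ℂ) ^ n = 1 := by rw [← Units.val_pow_eq_pow_val, hpow, Units.val_one]
    rw [hs] at h
    exact_mod_cast h
  have habs : (s σ).natAbs = 1 := by
    have h := congrArg Int.natAbs hZ
    rw [Int.natAbs_pow, Int.natAbs_one] at h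
    rcases Nat.pow_eq_one.mp h with h | h
    · exact h
    · exact absurd h hn.ne'
  rcases Int.natAbs_eq_iff.mp habs with h | h <;> rw [h] <;> norm_num

omit [W.IsElliptic] in
/-- **`chiHeightPairing` at a sign character is the height pairing with the projector**:
`Σ_σ χ(σ)·⟨σy₁, y₂⟩_{NT,H} = ⟨Y_χ y₁, y₂⟩_{NT,H}`, `Y_χ y := Σ_σ s(σ)·σy`.
[cite: Disegni2017, §1.1.1 P(f,χ) and (1.1.3) (arXiv v3 PDF p. 3 L32–40, p. 4 L35–41)] -/
theorem chiHeightPairing_eq_heightPairing_sum [W.IsElliptic] (hs : ∀ σ, ((χ σ : ℂˣ) : ℂ) = (s σ : ℂ))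
    (y₁ y₂ : (W.baseChange H).toAffine.Point) :
    chiHeightPairing W H G χ y₁ y₂ =
      ((heightPairing (∑ σ : G, s σ • pointGalHom W H σ.1 y₁) y₂ : ℝ) : ℂ) := by
  haveI : (W.baseChange H).IsElliptic := inferInstanceAs (W.map (algebraMap ℚ H)).IsElliptic
  rw [chiHeightPairing_def, finsum_eq_sum_of_fintype]
  simp_rw [hs]
  have h := sum_sign_mul_pairing_eq ((pointGalHom W H).comp G.subtype) s
    (fun a b : (W.baseChange H).toAffine.Point => heightPairing a b)
    (fun a b c => heightPairing_add_left_holds a b c) y₁ y₂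
  simp only [MonoidHom.coe_comp, Function.comp_apply, Subgroup.coe_subtype] at h
  rw [← h]
  push_cast
  rfl

omit [W.IsElliptic] in
/-- The Galois action on the projector: `τ(Y_χ y) = s(τ)·Y_χ y` for `τ ∈ G`.
[cite: Disegni2017, §1.1.1 A(χ) (arXiv v3 PDF p. 3 L40)] -/
theorem pointGalHom_sum_sign_smul (hs : ∀ σ, ((χ σ : ℂˣ) : ℂ) = (s σ : ℂ)) (τ : G)
    (y : (W.baseChange H).toAffine.Point) :
    pointGalHom W H τ.1 (∑ σ : G, s σ • pointGalHom W H σ.1 y) =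
      s τ • ∑ σ : G, s σ • pointGalHom W H σ.1 y := by
  obtain ⟨hmul, hsq⟩ := sign_mul_and_sq_of_eq G χ s hs
  have h := act_sum_sign_smul ((pointGalHom W H).comp G.subtype) s hmul hsq τ y
  simpa only [MonoidHom.coe_comp, Function.comp_apply, Subgroup.coe_subtype] using h

/-- **Doubling by Galois invariance of the Néron–Tate pairing** (`heightPairing_map_self`):
`|G|·⟨Y_χ y₁, y₂⟩ = ⟨Y_χ y₁, Y_χ y₂⟩`. [cite: BombieriGubler2001, Prop. 1.5.17]
[cite: Disegni2017, (1.1.3) (arXiv v3 PDF p. 4 L35–41)] -/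
theorem card_mul_heightPairing_sum_eq (hs : ∀ σ, ((χ σ : ℂˣ) : ℂ) = (s σ : ℂ))
    (y₁ y₂ : (W.baseChange H).toAffine.Point) :
    (Nat.card G : ℝ) * heightPairing (∑ σ : G, s σ • pointGalHom W H σ.1 y₁) y₂ =
      heightPairing (∑ σ : G, s σ • pointGalHom W H σ.1 y₁)
        (∑ σ : G, s σ • pointGalHom W H σ.1 y₂) := by
  haveI : (W.baseChange H).IsElliptic := inferInstanceAs (W.map (algebraMap ℚ H)).IsElliptic
  obtain ⟨hmul, hsq⟩ := sign_mul_and_sq_of_eq G χ s hs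
  have hinv : ∀ (τ : G) (a b : (W.baseChange H).toAffine.Point),
      heightPairing (((pointGalHom W H).comp G.subtype) τ a) (((pointGalHom W H).comp G.subtype) τ b) =
        heightPairing a b := fun τ a b => by
    simp only [MonoidHom.coe_comp, Function.comp_apply, Subgroup.coe_subtype, pointGalHom_apply]
    exact heightPairing_map_self (R := ℚ) (S := ℚ) (τ.1 : H →ₐ[ℚ] H) a b
  have h := card_mul_pairing_sum_eq ((pointGalHom W H).comp G.subtype) s
    (fun a b : (W.baseChange H).toAffine.Point => heightPairing a b) hmul hsq
    (fun a b c => heightPairing_add_left_holds a b c) (fun a b c => heightPairing_add_right a b c)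
    hinv y₁ y₂
  simp only [MonoidHom.coe_comp, Function.comp_apply, Subgroup.coe_subtype] at h
  rw [Nat.card_eq_fintype_card]
  exact h

/-- **Rank-one evaluation of `chiHeightPairing`**: if `m₁·Y_χ y₁ = k₁·R + T₁` and
`m₂·Y_χ y₂ = k₂·R + T₂` with `Tᵢ` torsion, then
`|G|·m₁·m₂ · chiHeightPairing W H G χ y₁ y₂ = k₁·k₂ · ĥ_H(R)`.
[cite: Disegni2017, (1.1.3) (arXiv v3 PDF p. 4 L35–41)] [cite: SilvermanAEC2009, Thm. VIII.9.3(c)-(d)] -/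
theorem card_mul_mul_chiHeightPairing_eq (hs : ∀ σ, ((χ σ : ℂˣ) : ℂ) = (s σ : ℂ))
    {y₁ y₂ R T₁ T₂ : (W.baseChange H).toAffine.Point} {m₁ m₂ k₁ k₂ : ℤ}
    (h₁ : m₁ • (∑ σ : G, s σ • pointGalHom W H σ.1 y₁) = k₁ • R + T₁)
    (h₂ : m₂ • (∑ σ : G, s σ • pointGalHom W H σ.1 y₂) = k₂ • R + T₂)
    (hT₁ : IsOfFinAddOrder T₁) (hT₂ : IsOfFinAddOrder T₂) :
    (Nat.card G : ℂ) * (m₁ : ℂ) * (m₂ : ℂ) * chiHeightPairing W H G χ y₁ y₂ =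
      (((k₁ : ℝ) * (k₂ : ℝ) * canonicalHeight R : ℝ) : ℂ) := by
  haveI : (W.baseChange H).IsElliptic := inferInstanceAs (W.map (algebraMap ℚ H)).IsElliptic
  rw [chiHeightPairing_eq_heightPairing_sum G χ s hs]
  have hG := card_mul_heightPairing_sum_eq G χ s hs y₁ y₂
  have hev := mul_mul_pairing_eq_of_zsmul_eq (fun a b : (W.baseChange H).toAffine.Point => heightPairing a b)
    (fun a b c => heightPairing_add_left_holds a b c) (fun a b c => heightPairing_add_right a b c)
    (fun a b ha => heightPairing_eq_zero_of_isOfFinAddOrder_left ha b)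
    (fun a b hb => heightPairing_eq_zero_of_isOfFinAddOrder_right a hb) h₁ h₂ hT₁ hT₂
  rw [heightPairing_self_holds] at hev
  have key : (Nat.card G : ℝ) * (m₁ : ℝ) * (m₂ : ℝ) *
      heightPairing (∑ σ : G, s σ • pointGalHom W H σ.1 y₁) y₂ = (k₁ : ℝ) * (k₂ : ℝ) * canonicalHeight R := by
    rw [← hev, ← hG]; ring
  rw [← key]
  push_cast
  ring

end NeronTate

/-! ### §3 The `p`-adic `χ`-pairing `chiPAdicPairing` at a sign character, `DH` `G`-invariant -/

section PAdic

open WeierstrassCurve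

variable {p : ℕ} [Fact p.Prime] (ι : PadicAlgCl p ≃+* ℂ) {W : WeierstrassCurve ℚ}
  {H : Type} [Field H] [NumberField H] (DH : PAdicHeightDataK W p H)
  (G : Subgroup (H ≃ₐ[ℚ] H)) (χ : G →* ℂˣ) (s : G → ℤ)

/-- The scalar `ι⁻¹(χ(σ))` read in `ℂ_p` is the integer `s(σ)`.
[cite: Disegni2017, (1.3.2) (arXiv v3 PDF p. 7 L40–44)] -/
theorem coe_symm_chi_eq_intCast (hs : ∀ σ, ((χ σ : ℂˣ) : ℂ) = (s σ : ℂ)) (σ : G) :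
    ((ι.symm ((χ σ : ℂˣ) : ℂ) : PadicAlgCl p) : ℂ_[p]) = (s σ : ℂ_[p]) := by
  rw [hs, map_intCast, PadicComplex.coe_eq, map_intCast]

/-- **`chiPAdicPairing` at a sign character is the datum's pairing with the projector**:
`Σ_σ ι⁻¹χ(σ)·⟨σy₁, y₂⟩_{DH} = ⟨Y_χ y₁, y₂⟩_{DH}` (read in `ℂ_p`).
[cite: Disegni2017, (1.3.1)–(1.3.2) (arXiv v3 PDF p. 7 L31–44)] -/
theorem chiPAdicPairing_eq_pairing_sum (hs : ∀ σ, ((χ σ : ℂˣ) : ℂ) = (s σ : ℂ))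
    (y₁ y₂ : (W.baseChange H).toAffine.Point) :
    chiPAdicPairing ι W H DH G χ y₁ y₂ =
      algebraMap ℚ_[p] ℂ_[p] (DH.pairing (∑ σ : G, s σ • pointGalHom W H σ.1 y₁) y₂) := by
  rw [chiPAdicPairing_def, finsum_eq_sum_of_fintype]
  simp_rw [coe_symm_chi_eq_intCast ι G χ s hs]
  have h := sum_sign_mul_pairing_eq ((pointGalHom W H).comp G.subtype) s
    (fun a b : (W.baseChange H).toAffine.Point => DH.pairing a b)
    (fun a b c => by simp only [map_add, AddMonoidHom.add_apply]) y₁ y₂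
  simp only [MonoidHom.coe_comp, Function.comp_apply, Subgroup.coe_subtype] at h
  rw [← h, map_sum]
  refine Finset.sum_congr rfl fun σ _ => ?_
  rw [map_mul, map_intCast]

/-- **Doubling by invariance, `p`-adic**: if the datum `DH` is `G`-invariant then
`|G|·⟨Y_χ y₁, y₂⟩_{DH} = ⟨Y_χ y₁, Y_χ y₂⟩_{DH}`. [cite: Disegni2017, (1.3.2) (arXiv v3 PDF p. 7 L40–44)] -/
theorem card_mul_pairing_sum_eq_padic (hs : ∀ σ, ((χ σ : ℂˣ) : ℂ) = (s σ : ℂ))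
    (hDH : ∀ (σ : G) (a b : (W.baseChange H).toAffine.Point),
      DH.pairing (pointGalHom W H σ.1 a) (pointGalHom W H σ.1 b) = DH.pairing a b)
    (y₁ y₂ : (W.baseChange H).toAffine.Point) :
    (Nat.card G : ℚ_[p]) * DH.pairing (∑ σ : G, s σ • pointGalHom W H σ.1 y₁) y₂ =
      DH.pairing (∑ σ : G, s σ • pointGalHom W H σ.1 y₁) (∑ σ : G, s σ • pointGalHom W H σ.1 y₂) := by
  obtain ⟨hmul, hsq⟩ := sign_mul_and_sq_of_eq G χ s hs
  have h := card_mul_pairing_sum_eq ((pointGalHom W H).comp G.subtype) s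
    (fun a b : (W.baseChange H).toAffine.Point => DH.pairing a b) hmul hsq
    (fun a b c => by simp only [map_add, AddMonoidHom.add_apply]) (fun a b c => by simp only [map_add])
    (fun τ a b => by
      simp only [MonoidHom.coe_comp, Function.comp_apply, Subgroup.coe_subtype]
      exact hDH τ a b) y₁ y₂
  simp only [MonoidHom.coe_comp, Function.comp_apply, Subgroup.coe_subtype] at h
  rw [Nat.card_eq_fintype_card]
  exact h

/-- **Rank-one evaluation of `chiPAdicPairing`** for a `G`-invariant datum: if `m₁·Y_χ y₁ = k₁·R + T₁`,
`m₂·Y_χ y₂ = k₂·R + T₂` with `Tᵢ` torsion, then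
`|G|·m₁·m₂ · chiPAdicPairing ι W H DH G χ y₁ y₂ = k₁·k₂ · ⟨R, R⟩_{DH}` (in `ℂ_p`).
[cite: Disegni2017, Theorem B (arXiv v3 PDF p. 8 L11–20), (1.3.2) (PDF p. 7 L40–44)] -/
theorem card_mul_mul_chiPAdicPairing_eq (hs : ∀ σ, ((χ σ : ℂˣ) : ℂ) = (s σ : ℂ))
    (hDH : ∀ (σ : G) (a b : (W.baseChange H).toAffine.Point),
      DH.pairing (pointGalHom W H σ.1 a) (pointGalHom W H σ.1 b) = DH.pairing a b)
    {y₁ y₂ R T₁ T₂ : (W.baseChange H).toAffine.Point} {m₁ m₂ k₁ k₂ : ℤ}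
    (h₁ : m₁ • (∑ σ : G, s σ • pointGalHom W H σ.1 y₁) = k₁ • R + T₁)
    (h₂ : m₂ • (∑ σ : G, s σ • pointGalHom W H σ.1 y₂) = k₂ • R + T₂)
    (hT₁ : IsOfFinAddOrder T₁) (hT₂ : IsOfFinAddOrder T₂) :
    (Nat.card G : ℂ_[p]) * (m₁ : ℂ_[p]) * (m₂ : ℂ_[p]) * chiPAdicPairing ι W H DH G χ y₁ y₂ =
      algebraMap ℚ_[p] ℂ_[p] ((k₁ : ℚ_[p]) * (k₂ : ℚ_[p]) * DH.pairing R R) := by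
  rw [chiPAdicPairing_eq_pairing_sum ι DH G χ s hs]
  have hG := card_mul_pairing_sum_eq_padic DH G χ s hs hDH y₁ y₂
  have hev := mul_mul_pairing_eq_of_zsmul_eq (fun a b : (W.baseChange H).toAffine.Point => DH.pairing a b)
    (fun a b c => by simp only [map_add, AddMonoidHom.add_apply]) (fun a b c => by simp only [map_add])
    (fun a b ha => DH.map_torsion a b ha) (fun a b hb => DH.map_torsion_right a b hb) h₁ h₂ hT₁ hT₂
  have key : (Nat.card G : ℚ_[p]) * (m₁ : ℚ_[p]) * (m₂ : ℚ_[p]) *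
      DH.pairing (∑ σ : G, s σ • pointGalHom W H σ.1 y₁) y₂ = (k₁ : ℚ_[p]) * (k₂ : ℚ_[p]) * DH.pairing R R := by
    rw [← hev, ← hG]; ring
  rw [← key]
  simp only [map_mul, map_natCast, map_intCast]

end PAdic

end Literature.NumberTheory.EllipticCurves.Disegni2017

end
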